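import Literature.AnabelianGeometry.EtaleTheta.KummerDataYCoord
import Literature.AnabelianGeometry.EtaleTheta.Discharge.Sec1Thm16iiiOfRootClauses
import Literature.AnabelianGeometry.EtaleTheta.Discharge.Sec1Prop15iQuotOfStdLog
import Literature.AnabelianGeometry.EtaleTheta.Discharge.Sec2YdduuTranslates
import HarnessLib

/-!
# [EtTh] Prop. 1.5 (i)(ii) «F¹/F² = Ẑ·log(U)», «F̈¹/F̈² = Ẑ·log(Ü)»: the root predicates `Prop15iQuot` /
# `Prop15iiQuot` from a `y`-COORDINATE KIT — generic (proof-only)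

Mochizuki, *The étale theta function and its Frobenioid-theoretic manifestations*, Publ. RIMS **45** (2009) [EtTh],
Prop. 1.5 (i)(ii) p. 23 (printed 249): «F¹/F² = Hom((Δ^tp_Y)^ell/Δ_Θ, Δ_Θ) = Ẑ·log(U) … where … the symbol log(U)
[denotes] the standard isomorphism (Δ^tp_Y)^ell/Δ_Θ ⥲ Ẑ(1) ⥲ Δ_Θ», «F̈¹/F̈² = … = Ẑ·log(Ü) … log(Ü) := ½·log(U)»
[cite: MochizukiEtTh2009, Prop 1.5 (ii) p.23].

abc-iut cell, layer L2, seat abc-iut-L2-t6 (gen 7), row «PROP15-QUOT FROM A Y-COORDINATE KIT». PROOF-ONLY (0 `def`),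
generic over ANY theta setting `D` and ANY `K : D.YCoordKit` (abc-iut-w5-d171's `KummerDataYCoord`: a character
`χ^Θ`, a `χ^Θ`-equivariant `ι : Ẑ → Δ_Θ`, a `y`-coordinate `ŷ` which is a `χ^Θ`-crossed homomorphism on `(Π^tp_Y)^Θ`
and even on `(Π^tp_Ÿ)^Θ`; `K.logU = [ι ∘ ŷ]`, `K.logUdd = [ι ∘ (ŷ/2)]`). Under the four KIT LAWS

* `hχ`  : `χ^Θ = 1` on the image `(Δ^tp_X)^Θ` of `Δ^tp_X` (the cyclotomic character is trivial on the geometric part),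
* `hker`: on `(Δ^tp_Y)^Θ`, `ŷ(g) = 1 ↔ g ∈ Δ_Θ`,
* `hY` / `hYdd` : `ŷ` takes every value `t ∈ Ẑ` on `(Δ^tp_Y)^Θ`, resp. every square `s²` on `(Δ^tp_Ÿ)^Θ`,
* `hι`  : `ι` is bijective,

the restriction `λ := ι ∘ ŷ` to `(Δ^tp_Y)^Θ` (resp. `λ̈ := ι ∘ (ŷ/2)` to `(Δ^tp_Ÿ)^Θ`) is a continuous HOMOMORPHISM onto
`Δ_Θ` with kernel `Δ_Θ` — abc-iut-L2-t1's `IsStdLog` («the standard isomorphism») — and it IS the restriction of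
`log(U)` (resp. `log(Ü)`): `exists_stdLog_Y`, `exists_stdLog_Ydd`. Hence, by abc-iut-L2-t1's
`prop15iQuot_of_stdLog_of_hasThetaTopology` (p445833) / `prop15iiQuot_of_stdLog_of_hasThetaTopology` (p444577),
**`Prop15iQuot E hC` and `Prop15iiQuot E hC` hold for EVERY Kummer datum `E` whose `log(U)` / `log(Ü)` are the kit
classes** (`prop15iQuot_of_laws`, `prop15iiQuot_of_laws`, `prop15iQuot_and_prop15iiQuot_of_laws`) at any setting
with `HasThetaTopology` and `IsEtThOrigin` — cores, `toKummerData`, every section datum `toKummerDataOfSection …`.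
Instances (stage-2 Tate-shear model `modelχq`, …) are separate files. Nothing of [EtTh] asserted; no side taken on
[IUTchIII] Cor. 3.12; typed ≠ proved.
-/

noncomputable section

namespace Literature.AnabelianGeometry.EtaleTheta

open Literature.AnabelianGeometry.SemiGraphs _root_.Function
open scoped IsMulCommutative

namespace ThetaSetting

namespace YCoordKit

variable {p : ℕ} [Fact p.Prime] {D : ThetaSetting p} (K : D.YCoordKit)

/-! ### `(Δ^tp_Ÿ)^Θ ≤ (Δ^tp_Y)^Θ ≤ (Π^tp_Y)^Θ` -/

/-- `(Δ^tp_Y)^Θ ≤ (Π^tp_Y)^Θ`. [cite: MochizukiEtTh2009, §1 p.12] -/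
theorem dtpYTheta_le_gtpYTheta : D.DtpYTheta ≤ D.GtpY.map D.toTheta := Subgroup.map_mono inf_le_left

-- `(Δ^tp_Ÿ)^Θ ≤ (Δ^tp_Y)^Θ` is abc-iut's landed `ThetaSetting.map_toTheta_dtpYddN_one_le_DtpYTheta` (`Sec2YdduuTranslates`).

/-! ### On `(Δ^tp_Y)^Θ` the `y`-coordinate is a homomorphism (kit law `χ^Θ|_Δ = 1`) -/

/-- **`ŷ(gh) = ŷ(g)·ŷ(h)` for `g ∈ (Δ^tp_Y)^Θ`, `h ∈ (Π^tp_Y)^Θ`** when `χ^Θ` is trivial on `(Δ^tp_X)^Θ`.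
[cite: MochizukiEtTh2009, Prop 1.5 (i) p.23] -/
theorem y_mul_of_chiT_eq_one (hχ : ∀ g ∈ D.DeltaTemp.map D.toTheta, K.chiT g = 1)
    {g : D.GtpTheta} (hg : g ∈ D.DtpYTheta) {h : D.GtpTheta} (hh : h ∈ D.GtpY.map D.toTheta) :
    K.y (g * h) = K.y g * K.y h := by
  rw [K.y_mul g (dtpYTheta_le_gtpYTheta hg) h hh, hχ g (dtpYTheta_le_deltaTheta_map hg), MulAut.one_apply]

/-- `ι(ŷ g) = 1 ↔ ŷ g = 1` for bijective `ι`. [cite: MochizukiEtTh2009, Prop 1.5 (i) p.23] -/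
theorem iota_y_eq_one_iff (hι : Bijective K.iota) (g : D.GtpTheta) : K.iota (K.y g) = 1 ↔ K.y g = 1 := by
  rw [← map_one K.iota, hι.1.eq_iff]

/-- `half t = 1 ↔ t = 1` on `2Ẑ`. [cite: MochizukiEtTh2009, Prop 1.5 (ii) p.23] -/
theorem half_eq_one_iff (t : SettingModel.sqHom.range) : SettingModel.half t = 1 ↔ (t : SettingModel.ZH) = 1 := by
  constructor
  · intro h
    have hsq := SettingModel.half_sq t
    rw [h, one_pow] at hsq
    exact hsq.symm
  · intro h
    have ht : t = 1 := Subtype.ext h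
    rw [ht, map_one]

/-- `half ⟨s², _⟩ = s`. [cite: MochizukiEtTh2009, Prop 1.5 (ii) p.23] -/
theorem half_sq_eq (s : SettingModel.ZH) (hs : s ^ 2 ∈ SettingModel.sqHom.range) :
    SettingModel.half ⟨s ^ 2, hs⟩ = s := by
  apply SettingModel.sqHom_injective
  rw [SettingModel.sqHom_apply, SettingModel.sqHom_apply, SettingModel.half_sq]

/-! ### The standard logarithm on `(Δ^tp_Y)^Θ`: `λ = ι ∘ ŷ` -/

/-- **The standard isomorphism on the `Y`-side from the kit**: under the kit laws, `λ := ι ∘ ŷ` restricted to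
`(Δ^tp_Y)^Θ` is a continuous homomorphism onto `Δ_Θ` with kernel `Δ_Θ` (abc-iut-L2-t1's `IsStdLog`), and it agrees with
the `log(U)`-cocycle `K.logUFun`. [cite: MochizukiEtTh2009, Prop 1.5 (i) p.23] -/
theorem exists_stdLog_Y (hχ : ∀ g ∈ D.DeltaTemp.map D.toTheta, K.chiT g = 1)
    (hker : ∀ g ∈ D.DtpYTheta, K.y g = 1 ↔ g ∈ D.DeltaTheta)
    (hY : ∀ t : SettingModel.ZH, ∃ g ∈ D.DtpYTheta, K.y g = t) (hι : Bijective K.iota) :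
    ∃ lam : D.DtpYTheta →ₜ* D.DeltaTheta, IsStdLog lam ∧
      ∀ h, lam h = K.logUFun ⟨h.1, dtpYTheta_le_gtpYTheta h.2⟩ := by
  refine ⟨⟨MonoidHom.mk' (fun h => K.iota (K.y h)) fun x y => ?_, ?_⟩, ⟨?_, ?_⟩, fun h => rfl⟩
  · change K.iota (K.y ((x : D.GtpTheta) * y)) = K.iota (K.y x) * K.iota (K.y y)
    rw [K.y_mul_of_chiT_eq_one hχ x.2 (dtpYTheta_le_gtpYTheta y.2), map_mul]
  · exact K.continuous_iota.comp (K.continuous_y.comp continuous_subtype_val)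
  · intro a
    obtain ⟨t, rfl⟩ := hι.2 a
    obtain ⟨g, hg, hgt⟩ := hY t
    exact ⟨⟨g, hg⟩, congrArg K.iota hgt⟩
  · intro h
    change K.iota (K.y h) = 1 ↔ _
    rw [K.iota_y_eq_one_iff hι]
    exact hker h h.2

/-- **Clause (a) of Prop. 1.5 (i) for the kit class**: `res_{(Δ^tp_Y)^Θ} log(U) = [λ]` for the standard logarithm of
`exists_stdLog_Y`. [cite: MochizukiEtTh2009, Prop 1.5 (i) p.23] -/
theorem exists_stdLog_res_logU (hχ : ∀ g ∈ D.DeltaTemp.map D.toTheta, K.chiT g = 1)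
    (hker : ∀ g ∈ D.DtpYTheta, K.y g = 1 ↔ g ∈ D.DeltaTheta)
    (hY : ∀ t : SettingModel.ZH, ∃ g ∈ D.DtpYTheta, K.y g = t) (hι : Bijective K.iota) :
    ∃ lam : D.DtpYTheta →ₜ* D.DeltaTheta, IsStdLog lam ∧
      ContH1.res (MonoidHom.id D.GtpTheta) D.DeltaTheta dtpYTheta_le_gtpYTheta K.logU =
        homClass dtpYTheta_le_deltaTheta_map lam := by
  obtain ⟨lam, hstd, hlam⟩ := K.exists_stdLog_Y hχ hker hY hι
  refine ⟨lam, hstd, ?_⟩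
  change ContH1.mk _ _ = ContH1.mk _ _
  exact ContH1.mk_congr _ (funext fun h => (hlam h).symm) _ _

/-! ### The standard logarithm on `(Δ^tp_Ÿ)^Θ`: `λ̈ = ι ∘ (ŷ/2)` -/

/-- **The standard isomorphism on the `Ÿ`-side from the kit**: under the kit laws, `λ̈ := ι ∘ (ŷ/2)` restricted to
`(Δ^tp_Ÿ)^Θ` is a continuous homomorphism onto `Δ_Θ` with kernel `Δ_Θ` (`IsStdLog`), and it agrees with the
`log(Ü)`-cocycle `K.logUddFun`. [cite: MochizukiEtTh2009, Prop 1.5 (ii) p.23] -/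
theorem exists_stdLog_Ydd (hχ : ∀ g ∈ D.DeltaTemp.map D.toTheta, K.chiT g = 1)
    (hker : ∀ g ∈ (D.DtpYddN 1).map D.toTheta, K.y g = 1 ↔ g ∈ D.DeltaTheta)
    (hYdd : ∀ s : SettingModel.ZH, ∃ g ∈ (D.DtpYddN 1).map D.toTheta, K.y g = s ^ 2) (hι : Bijective K.iota) :
    ∃ lam : ↥((D.DtpYddN 1).map D.toTheta) →ₜ* D.DeltaTheta, IsStdLog lam ∧
      ∀ h, lam h = K.logUddFun ⟨h.1, D.map_toTheta_DtpYddN_one_le h.2⟩ := by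
  refine ⟨⟨MonoidHom.mk' (fun h => K.logUddFun ⟨h.1, D.map_toTheta_DtpYddN_one_le h.2⟩) fun x y => ?_, ?_⟩,
    ⟨?_, ?_⟩, fun h => rfl⟩
  · change K.iota (SettingModel.half ⟨K.y ((x : D.GtpTheta) * y), _⟩) =
      K.iota (SettingModel.half ⟨K.y x, _⟩) * K.iota (SettingModel.half ⟨K.y y, _⟩)
    rw [← map_mul, ← map_mul]
    congr 1
    apply SettingModel.sqHom_injective
    rw [SettingModel.sqHom_apply, SettingModel.sqHom_apply, SettingModel.half_sq, SettingModel.half_sq]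
    exact K.y_mul_of_chiT_eq_one hχ (map_toTheta_dtpYddN_one_le_DtpYTheta x.2)
      (dtpYTheta_le_gtpYTheta (map_toTheta_dtpYddN_one_le_DtpYTheta y.2))
  · exact (K.logUddFun_mem).1.comp (continuous_subtype_val.subtype_mk _)
  · intro a
    obtain ⟨s, rfl⟩ := hι.2 a
    obtain ⟨g, hg, hgs⟩ := hYdd s
    refine ⟨⟨g, hg⟩, ?_⟩
    change K.iota (SettingModel.half ⟨K.y g, _⟩) = K.iota s
    congr 1
    have hmem : s ^ 2 ∈ SettingModel.sqHom.range := ⟨s, rfl⟩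
    rw [← half_sq_eq s hmem]
    congr 1
    exact Subtype.ext hgs
  · intro h
    change K.iota (SettingModel.half ⟨K.y h, _⟩) = 1 ↔ _
    rw [← map_one K.iota, hι.1.eq_iff, half_eq_one_iff]
    exact hker h h.2

/-- **Clause (a) of Prop. 1.5 (ii) for the kit class**: `res_{(Δ^tp_Ÿ)^Θ} log(Ü) = [λ̈]` for the standard logarithm
of `exists_stdLog_Ydd`. [cite: MochizukiEtTh2009, Prop 1.5 (ii) p.23] -/
theorem exists_stdLog_res_logUdd (hχ : ∀ g ∈ D.DeltaTemp.map D.toTheta, K.chiT g = 1)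
    (hker : ∀ g ∈ (D.DtpYddN 1).map D.toTheta, K.y g = 1 ↔ g ∈ D.DeltaTheta)
    (hYdd : ∀ s : SettingModel.ZH, ∃ g ∈ (D.DtpYddN 1).map D.toTheta, K.y g = s ^ 2) (hι : Bijective K.iota) :
    ∃ lam : ↥((D.DtpYddN 1).map D.toTheta) →ₜ* D.DeltaTheta, IsStdLog lam ∧
      ContH1.res (MonoidHom.id D.GtpTheta) D.DeltaTheta D.map_toTheta_DtpYddN_one_le K.logUdd =
        homClass dtpYddTheta_le_deltaTheta_map lam := by
  obtain ⟨lam, hstd, hlam⟩ := K.exists_stdLog_Ydd hχ hker hYdd hι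
  refine ⟨lam, hstd, ?_⟩
  change ContH1.mk _ _ = ContH1.mk _ _
  exact ContH1.mk_congr _ (funext fun h => (hlam h).symm) _ _

/-- The `Ÿ`-side kernel law follows from the `Y`-side one. [cite: MochizukiEtTh2009, Prop 1.5 (ii) p.23] -/
theorem ker_law_Ydd_of_Y (hker : ∀ g ∈ D.DtpYTheta, K.y g = 1 ↔ g ∈ D.DeltaTheta) :
    ∀ g ∈ (D.DtpYddN 1).map D.toTheta, K.y g = 1 ↔ g ∈ D.DeltaTheta :=
  fun g hg => hker g (map_toTheta_dtpYddN_one_le_DtpYTheta hg)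

/-! ### Prop. 1.5 (i)/(ii) «= Ẑ·log» for every Kummer datum carrying the kit classes -/

/-- **[EtTh] Prop. 1.5 (i) «F¹/F² = Ẑ·log(U)» from the kit laws**, for EVERY Kummer datum `E` with `E.logU = K.logU`, at
a setting with the census topology predicate and of [EtTh] origin (clauses (b)(c) by abc-iut-L2-t1's
`prop15iQuot_of_stdLog_of_hasThetaTopology`). [cite: MochizukiEtTh2009, Prop 1.5 (i) p.23] -/
theorem prop15iQuot_of_laws (hC : D.Compat) (hT : D.HasThetaTopology) (hO : D.IsEtThOrigin)
    (hχ : ∀ g ∈ D.DeltaTemp.map D.toTheta, K.chiT g = 1)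
    (hker : ∀ g ∈ D.DtpYTheta, K.y g = 1 ↔ g ∈ D.DeltaTheta)
    (hY : ∀ t : SettingModel.ZH, ∃ g ∈ D.DtpYTheta, K.y g = t) (hι : Bijective K.iota)
    {E : D.KummerData} (hE : E.logU = K.logU) : Prop15iQuot E hC := by
  obtain ⟨lam, hstd, hres⟩ := K.exists_stdLog_res_logU hχ hker hY hι
  rw [← hE] at hres
  exact prop15iQuot_of_stdLog_of_hasThetaTopology hC hT hO hstd hres

/-- **[EtTh] Prop. 1.5 (ii) «F̈¹/F̈² = Ẑ·log(Ü)» from the kit laws**, for EVERY Kummer datum `E` with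
`E.logUdd = K.logUdd` (clauses (b)(c) by abc-iut-L2-t1's `prop15iiQuot_of_stdLog_of_hasThetaTopology`).
[cite: MochizukiEtTh2009, Prop 1.5 (ii) p.23] -/
theorem prop15iiQuot_of_laws (hC : D.Compat) (hT : D.HasThetaTopology) (hO : D.IsEtThOrigin)
    (hχ : ∀ g ∈ D.DeltaTemp.map D.toTheta, K.chiT g = 1)
    (hker : ∀ g ∈ (D.DtpYddN 1).map D.toTheta, K.y g = 1 ↔ g ∈ D.DeltaTheta)
    (hYdd : ∀ s : SettingModel.ZH, ∃ g ∈ (D.DtpYddN 1).map D.toTheta, K.y g = s ^ 2) (hι : Bijective K.iota)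
    {E : D.KummerData} (hE : E.logUdd = K.logUdd) : Prop15iiQuot E hC := by
  obtain ⟨lam, hstd, hres⟩ := K.exists_stdLog_res_logUdd hχ hker hYdd hι
  rw [← hE] at hres
  exact prop15iiQuot_of_stdLog_of_hasThetaTopology hC hT hO hstd hres

/-- **Both identifications at once** for a Kummer datum carrying both kit classes.
[cite: MochizukiEtTh2009, Prop 1.5 (ii) p.23] -/
theorem prop15iQuot_and_prop15iiQuot_of_laws (hC : D.Compat) (hT : D.HasThetaTopology) (hO : D.IsEtThOrigin)
    (hχ : ∀ g ∈ D.DeltaTemp.map D.toTheta, K.chiT g = 1)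
    (hker : ∀ g ∈ D.DtpYTheta, K.y g = 1 ↔ g ∈ D.DeltaTheta)
    (hY : ∀ t : SettingModel.ZH, ∃ g ∈ D.DtpYTheta, K.y g = t)
    (hYdd : ∀ s : SettingModel.ZH, ∃ g ∈ (D.DtpYddN 1).map D.toTheta, K.y g = s ^ 2) (hι : Bijective K.iota)
    {E : D.KummerData} (hU : E.logU = K.logU) (hUdd : E.logUdd = K.logUdd) :
    Prop15iQuot E hC ∧ Prop15iiQuot E hC :=
  ⟨K.prop15iQuot_of_laws hC hT hO hχ hker hY hι hU,
    K.prop15iiQuot_of_laws hC hT hO hχ (K.ker_law_Ydd_of_Y hker) hYdd hι hUdd⟩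

/-- **The finite fragments bound by the cell's consumers, from the kit laws**: `hL` («`log(Ü)^n ∈ F̈² → n = 0`») and
`htf` («`d ∈ F̈¹`, `d² ∈ F̈²` ⇒ `d ∈ F̈²`») for every Kummer datum carrying the kit class `log(Ü)`
(abc-iut-L2-t1's `Prop15iiQuot.hL_of_origin` / `.htf_of_origin`). [cite: MochizukiEtTh2009, Prop 1.5 (ii) p.23] -/
theorem hL_and_htf_of_laws (hC : D.Compat) (hT : D.HasThetaTopology) (hO : D.IsEtThOrigin)
    (hχ : ∀ g ∈ D.DeltaTemp.map D.toTheta, K.chiT g = 1)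
    (hker : ∀ g ∈ (D.DtpYddN 1).map D.toTheta, K.y g = 1 ↔ g ∈ D.DeltaTheta)
    (hYdd : ∀ s : SettingModel.ZH, ∃ g ∈ (D.DtpYddN 1).map D.toTheta, K.y g = s ^ 2) (hι : Bijective K.iota)
    {E : D.KummerData} (hE : E.logUdd = K.logUdd) :
    (∀ n : ℤ, E.logUdd ^ n ∈ (Fdd2 : Subgroup (D.H1Theta (D.GtpYdd.map D.toTheta))) → n = 0) ∧
      ∀ d ∈ Fdd1 hC, d * d ∈ (Fdd2 : Subgroup (D.H1Theta (D.GtpYdd.map D.toTheta))) →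
        d ∈ (Fdd2 : Subgroup (D.H1Theta (D.GtpYdd.map D.toTheta))) :=
  have h := K.prop15iiQuot_of_laws hC hT hO hχ hker hYdd hι hE
  ⟨fun _ hn => h.hL_of_origin hO hn, fun _ hd hsq => h.htf_of_origin hO hd hsq⟩

end YCoordKit

end ThetaSetting

end Literature.AnabelianGeometry.EtaleTheta

end
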